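import Summits.AtomisticToContinuum.FouriersLaw.Theses.PuiseuxTransferLedger
import Summits.AtomisticToContinuum.FouriersLaw.Theorems.PhononMeanFreePathBoundaryKubo
import Summits.AtomisticToContinuum.FouriersLaw.Theorems.PuiseuxTransferLedgerTwoModeBulkStubProfileTTCF
import Summits.AtomisticToContinuum.FouriersLaw.Theorems.PuiseuxTransferLedgerTwoModeBulkStubProfileLimitExchange
import Summits.AtomisticToContinuum.FouriersLaw.Theorems.PuiseuxTransferLedgerTwoModeBulkStubProfileSumRule

/-!
# Line `Sketch` — skeleton for crux `PuiseuxTransferLedger.TwoModeBulk`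
(item stmt-AtomisticToContinuum-12111; lead prover, opening round; built on the ideator sketches
`Cruxes/TwoModeBulk/SketchIdeator2.lean` (card `cut-bond-harmonic-measure`: profile = corner column of the
`ω = 0` kinetic kernel) and `SketchIdeator1.lean` (card `screened-precision-wiener-hopf`), reshaped onto the
LANDED fixed-`N` linear-response technology of crux `PhononMeanFreePath.BoundaryKubo` (line `gibbs-ttcf`).

THE CRUX. For `P = pinnedChain ω₂ lam β γ` (all `> 0`), under weak-NESS uniqueness, along every steady family `μ`,
for every `T > 0` there are `r, θ ∈ [0,1), C` NOT depending on `N` such that for every `N`, every response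
coefficient `d` (limit of `totalCurrent(μ N (T+δ/2) (T-δ/2))/δ`), every kinetic-temperature response profile `t`
(limits of `(μ_{N,δ}(p_i²) - μ_{N,0}(p_i²))/δ`) and every bond `(i, i+1)`:
`|t i - t (i+1) - r·d/(N-1)| ≤ C·|d/(N-1)|·(θ^i + θ^(N-2-i))`.

THE LINE. Two halves of different nature.
(I) FIXED `N` (provable now, by re-threading the ten landed stub files of `BoundaryKubo`/`gibbs-ttcf` with the
observable `p_N²` replaced by `p_i²`): under the crux's hypotheses the response limits EXIST and are EXPLICIT
equilibrium objects of the open chain with both baths at `T` — writing `μ₀ = P.gibbsMeasure (N+1) T`,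
`K_t = P.transitionKernel (N+1) T T t`, `Y_i(t) = Cov_{μ₀}(p_0², K_t p_i²)`, `X_i(t) = Cov_{μ₀}(p_N², K_t p_i²)`:
  `d = D_{N+1} = N(γ²/T²)∫₀^∞ Y_N`                      (`boundaryKubo_proof`, LANDED),
  `t i = (γ/2T²)(∫₀^∞ Y_i - ∫₀^∞ X_i)`                  (`stub_profileTTCF` + `stub_profileLimitExchange`),
  `∫₀^∞ Y_i + ∫₀^∞ X_i = T²/γ`, both integrable          (`stub_profileSumRule`),
so `t i = (γ/T²)∫₀^∞ Y_i - 1/2` (the "cut-bond / corner-column" identity of the card: `t_i + 1/2` is the fraction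
of an energy excess at site `i` that leaves through the LEFT bath). By-product: the route's support items
`FiniteResponseProfile` (stmt-12011) follows from (I) (`finiteResponseProfile_of_stubs`; the tree meanwhile also holds
an independent proof `Theorems.finiteResponseProfile_proof`, and `ContactIdentity`, stmt-12112, is proved there too).
(II) `N`-UNIFORM (the physics; `TwoModeProfile`, split into the lead's stubs `stub_layerRelaxation` + `stub_bulkSlope`): the explicit equilibrium profile
`i ↦ (γ/T²)∫₀^∞ Y_i - 1/2` of the `(N+1)`-site open equilibrium chain has increments `r·g + O(g(θ^i + θ^(N-1-i)))`,
`g = D_{N+1}/N`, with `(r, θ, C)` independent of `N` — a statement about ONE family of equilibrium time-integrated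
kinetic covariances (no non-equilibrium state, no response limit, no family quantifier, no uniqueness hypothesis).
COMPOSITION (`TwoModeBulk_of : stub_layerRelaxation → stub_bulkSlope → TwoModeBulk`, sorry-free, via `core_of_profile`):
limits along `𝓝[≠] 0` are unique, so the crux's `d`, `t i` ARE the explicit values; then (II) is the crux's inequality
verbatim (`(N+1) - 1 = N`, `(N+1) - 2 - i = N - 1 - i`). `twoModeBulk_iff_twoModeProfile`: the reduction is lossless.

Registered stubs (5): `stub_profileTTCF` (M), `stub_profileLimitExchange` (M), `stub_profileSumRule` (M) — fixed `N`;
`stub_layerRelaxation`, `stub_bulkSlope` (crux-sized, HARDEST — lead) — `N`-uniform, jointly equivalent to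
`TwoModeProfile` (reshape of the opening stub `stub_twoModeProfile`, cycle 1). Each is `Holds.stub_<name> : <statement> := by sorry` plus the
by-name handle `def stub_<name> : Prop := type_of% Holds.stub_<name>`.

CYCLE 2 (continuation lead c1, 2026-08-16): the COMPOSITION itself is now durable in `Theorems/`, independently of the two
open stubs — registered assembly sub-goals (`ledger workitem stub-add`) `twoMode_glue` (the abstract form of
`Glue.twoMode_of_layer_and_slope` + `twoModeProfile_of`; LANDED p126533, `Theorems/PuiseuxTransferLedgerTwoModeBulkGlue.lean`)
and `twoModeBulk_iff_twoModeProfile` (Parts III–VI below with the defs inlined, rider `twoModeBulk_of_stubs :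
stub_layerRelaxation-statement → stub_bulkSlope-statement → TwoModeBulk`; `Theorems/PuiseuxTransferLedgerTwoModeBulkReduction.lean`).
The two `N`-uniform stubs are handed back as crux-sized (`promote-stub`): they are kernel-checked EQUIVALENT to the crux, and
their content — an `N`-uniform local Ohm law with Knudsen layers for the deterministic anharmonic chain — is open at the
microscopic AND at the kinetic level (pinned-band linearised Boltzmann operator: formally infinite collision frequency, no
relaxation-time splitting [Lukkarinen2016 §3.4]; odd-sector gap open [AokiLukkarinenSpohn2006 after (4.9)]). Dossier:
`Cruxes/TwoModeBulk/Lines/Sketch.md` §Cycle 2.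
-/

noncomputable section

open scoped NNReal ENNReal Topology
open MeasureTheory Filter Set

namespace Summit.AtomisticToContinuum.FouriersLaw.Cruxes.TwoModeBulk.Sketch

open Literature.MathematicalPhysics.KineticTheory.HeatConduction
open Summit.AtomisticToContinuum.FouriersLaw.Theorems.BoundaryKubo.Negative.LoadBearing
  (kuboIntegrand kuboValue LimitClause UniqueSteady SteadyFamily boundaryKubo_iff steadyFamily_apply_self)
open Summit.AtomisticToContinuum.FouriersLaw.Theorems.PhononMeanFreePathBoundaryKubo (boundaryKubo_proof)
open Summit.AtomisticToContinuum.FouriersLaw.Theorems.IncoherentBounded (integral_momentum_sq_gibbsMeasure)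

/-! ## Part I — vocabulary (abbreviations of verbatim sub-terms of the stubs; nothing new is posited) -/

/-- `Y_i(t) = Cov_{μ₀}(p_0², K_t p_i²)`: left-contact / site-`i` time-`t` kinetic covariance of the `(N+1)`-site
open equilibrium chain (`μ₀ = gibbsMeasure (N+1) T`, `K_t` the constructed equal-temperature kernels).
At `i = Fin.last N` this is `kuboIntegrand`. [folklore] -/
def leftIntegrand (ω₂ lam β γ T : ℝ) (N : ℕ) (i : Fin (N + 1)) (t : ℝ) : ℝ :=
  (∫ z, (z.2 0) ^ 2 * (∫ y, (y.2 i) ^ 2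
      ∂((pinnedChain ω₂ lam β γ).transitionKernel (N + 1) T T t.toNNReal z))
      ∂((pinnedChain ω₂ lam β γ).gibbsMeasure (N + 1) T)) -
    (∫ z, (z.2 0) ^ 2 ∂((pinnedChain ω₂ lam β γ).gibbsMeasure (N + 1) T)) *
      (∫ z, (∫ y, (y.2 i) ^ 2
        ∂((pinnedChain ω₂ lam β γ).transitionKernel (N + 1) T T t.toNNReal z))
        ∂((pinnedChain ω₂ lam β γ).gibbsMeasure (N + 1) T))

/-- `X_i(t) = Cov_{μ₀}(p_N², K_t p_i²)`: right-contact / site-`i` kinetic covariance. [folklore] -/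
def rightIntegrand (ω₂ lam β γ T : ℝ) (N : ℕ) (i : Fin (N + 1)) (t : ℝ) : ℝ :=
  (∫ z, (z.2 (Fin.last N)) ^ 2 * (∫ y, (y.2 i) ^ 2
      ∂((pinnedChain ω₂ lam β γ).transitionKernel (N + 1) T T t.toNNReal z))
      ∂((pinnedChain ω₂ lam β γ).gibbsMeasure (N + 1) T)) -
    (∫ z, (z.2 (Fin.last N)) ^ 2 ∂((pinnedChain ω₂ lam β γ).gibbsMeasure (N + 1) T)) *
      (∫ z, (∫ y, (y.2 i) ^ 2
        ∂((pinnedChain ω₂ lam β γ).transitionKernel (N + 1) T T t.toNNReal z))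
        ∂((pinnedChain ω₂ lam β γ).gibbsMeasure (N + 1) T))

/-- The Kubo value of the kinetic-temperature response at site `i`:
`(γ/2T²)(∫₀^∞ Y_i - ∫₀^∞ X_i)`. [folklore] -/
def responseValue (ω₂ lam β γ T : ℝ) (N : ℕ) (i : Fin (N + 1)) : ℝ :=
  γ / (2 * T ^ 2) * ((∫ t in Ioi (0 : ℝ), leftIntegrand ω₂ lam β γ T N i t) -
    ∫ t in Ioi (0 : ℝ), rightIntegrand ω₂ lam β γ T N i t)

/-- The one-sided ("cut-bond") form of the profile: `(γ/T²)∫₀^∞ Y_i - 1/2`. [folklore] -/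
def profileValue (ω₂ lam β γ T : ℝ) (N : ℕ) (i : Fin (N + 1)) : ℝ :=
  γ / T ^ 2 * (∫ t in Ioi (0 : ℝ), leftIntegrand ω₂ lam β γ T N i t) - 1 / 2

/-- `leftIntegrand` at the far end is BoundaryKubo's `kuboIntegrand`. [folklore] -/
theorem leftIntegrand_last (ω₂ lam β γ T : ℝ) (N : ℕ) :
    leftIntegrand ω₂ lam β γ T N (Fin.last N) = kuboIntegrand ω₂ lam β γ T N := rfl

/-! ## Part II — registered stubs (`sorry` only here) -/

/-- **Stub 1 — `stub_profileTTCF` (fixed `N`, size M) — CLOSED (p103720, worker A, cycle 1): the exact finite-time, finite-`δ` Gibbs-tested transient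
time-correlation identity for the kinetic temperature AT EVERY SITE `i`** of the `(N+1)`-site pinned chain:
for `T > 0`, `|δ| < 2T`, `S ≥ 0`, `μ₀ = gibbsMeasure (N+1) T`, `K^δ_s = transitionKernel (N+1) (T+δ/2) (T-δ/2) s`,
`μ₀(K^δ_S p_i²) - μ₀(p_i²) = δ (γ/2T²) ∫₀^S μ₀((p_0² - p_N²) · K^δ_s p_i²) ds`.
VERBATIM the landed `BoundaryKubo.GibbsTtcf.stub_gibbsTTCF` (`Theorems/PhononMeanFreePathBoundaryKuboGibbsTTCF.lean`)
with the observable `p_N²` (`y.2 (Fin.last N)`) replaced by `p_i²` (`y.2 i`) — its proof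
(`pinnedChain_gibbsTTCF_density`: Lebesgue duality of the Langevin kernels, Dynkin for the Gibbs density along the
reversed equation, `L̂_δ ρ_T = (-2γ + δ(γ/2T²)(p_0² - p_N²))ρ_T`, Fubini) uses of the observable only continuity and
`|p_i²| ≤ (2/θ)e^{θH}` (`abs_sq_momentum_le_exp`), which hold at every site. -/
theorem Holds.stub_profileTTCF :
    ∀ ω₂ lam β γ : ℝ, 0 < ω₂ → 0 < lam → 0 < β → 0 < γ → ∀ (N : ℕ) (T : ℝ), 0 < T →
      ∀ (i : Fin (N + 1)) (δ : ℝ), |δ| < 2 * T → ∀ S : ℝ, 0 ≤ S →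
        (∫ z, (∫ y, (y.2 i) ^ 2
            ∂((Literature.MathematicalPhysics.KineticTheory.HeatConduction.pinnedChain ω₂ lam β γ).transitionKernel
              (N + 1) (T + δ / 2) (T - δ / 2) S.toNNReal z))
            ∂((Literature.MathematicalPhysics.KineticTheory.HeatConduction.pinnedChain ω₂ lam β γ).gibbsMeasure
              (N + 1) T)) -
          (∫ z, (z.2 i) ^ 2
            ∂((Literature.MathematicalPhysics.KineticTheory.HeatConduction.pinnedChain ω₂ lam β γ).gibbsMeasure
              (N + 1) T)) =
        δ * (γ / (2 * T ^ 2)) *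
          ∫ s in (0 : ℝ)..S, ∫ z, ((z.2 0) ^ 2 - (z.2 (Fin.last N)) ^ 2) *
            (∫ y, (y.2 i) ^ 2
              ∂((Literature.MathematicalPhysics.KineticTheory.HeatConduction.pinnedChain ω₂ lam β γ).transitionKernel
                (N + 1) (T + δ / 2) (T - δ / 2) s.toNNReal z))
            ∂((Literature.MathematicalPhysics.KineticTheory.HeatConduction.pinnedChain ω₂ lam β γ).gibbsMeasure
              (N + 1) T) :=
  -- CLOSED (worker A, p103720): `Theorems/PuiseuxTransferLedgerTwoModeBulkStubProfileTTCF.lean`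
  Summit.AtomisticToContinuum.FouriersLaw.Theorems.TwoModeBulk.Sketch.stub_profileTTCF

/-- **Stub 2 — `stub_profileLimitExchange` (fixed `N`, size M) — CLOSED (p104522, worker B, cycle 1): the linear response of the kinetic temperature
AT EVERY SITE along any steady family under weak-NESS uniqueness**: given the TTCF identity of stub 1 (taken as a
hypothesis, verbatim), for every `T > 0`, `N`, `i`:
`(μ_{T+δ/2,T-δ/2}(p_i²) - T)/δ → (γ/2T²)(∫₀^∞ Y_i - ∫₀^∞ X_i)` as `δ → 0`, `δ ≠ 0`,
`Y_i(t) = Cov_{μ₀}(p_0², K_t p_i²)`, `X_i(t) = Cov_{μ₀}(p_N², K_t p_i²)`.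
VERBATIM the landed `BoundaryKubo.GibbsTtcf.stub_limitExchange` (`Theorems/PhononMeanFreePathBoundaryKuboLimitExchange.lean`)
with `p_N²` replaced by `p_i²` in the observable slots (NOT in the perturbation `p_0² - p_N²`); its other two
hypotheses are LANDED theorems to be used inside the proof: locally uniform Harris
`stub_uniformHarris_of_minorization (stub_uniformMinorization_of stub_uniformLocalMinorization stub_uniformBallGeHalf stub_jointFeller)`
and `stub_kernelContinuity` (stated for a general continuous polynomially bounded `f`). Proof as there: the family
member at `0 < |δ| ≤ δ₀` is the Harris steady state (uniqueness), at `δ = 0` the Gibbs state; `S → ∞` in the TTCF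
identity; `δ → 0` inside by dominated convergence (uniform `M e^{-cs}`, kernel continuity); `Ψ(0) = ∫Y_i - ∫X_i`
(`integral_kubo_sub_auto` with `p_i²`). -/
theorem Holds.stub_profileLimitExchange :
    (∀ ω₂ lam β γ : ℝ, 0 < ω₂ → 0 < lam → 0 < β → 0 < γ → ∀ (N : ℕ) (T : ℝ), 0 < T →
      ∀ (i : Fin (N + 1)) (δ : ℝ), |δ| < 2 * T → ∀ S : ℝ, 0 ≤ S →
        (∫ z, (∫ y, (y.2 i) ^ 2
            ∂((Literature.MathematicalPhysics.KineticTheory.HeatConduction.pinnedChain ω₂ lam β γ).transitionKernel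
              (N + 1) (T + δ / 2) (T - δ / 2) S.toNNReal z))
            ∂((Literature.MathematicalPhysics.KineticTheory.HeatConduction.pinnedChain ω₂ lam β γ).gibbsMeasure
              (N + 1) T)) -
          (∫ z, (z.2 i) ^ 2
            ∂((Literature.MathematicalPhysics.KineticTheory.HeatConduction.pinnedChain ω₂ lam β γ).gibbsMeasure
              (N + 1) T)) =
        δ * (γ / (2 * T ^ 2)) *
          ∫ s in (0 : ℝ)..S, ∫ z, ((z.2 0) ^ 2 - (z.2 (Fin.last N)) ^ 2) *
            (∫ y, (y.2 i) ^ 2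
              ∂((Literature.MathematicalPhysics.KineticTheory.HeatConduction.pinnedChain ω₂ lam β γ).transitionKernel
                (N + 1) (T + δ / 2) (T - δ / 2) s.toNNReal z))
            ∂((Literature.MathematicalPhysics.KineticTheory.HeatConduction.pinnedChain ω₂ lam β γ).gibbsMeasure
              (N + 1) T)) →
    ∀ ω₂ lam β γ : ℝ, 0 < ω₂ → 0 < lam → 0 < β → 0 < γ →
      (∀ (N : ℕ) (T_L T_R : ℝ), 0 < T_L → 0 < T_R →
        ∀ μ ν : Measure (Literature.MathematicalPhysics.KineticTheory.HeatConduction.PhaseSpace N),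
          (Literature.MathematicalPhysics.KineticTheory.HeatConduction.pinnedChain ω₂ lam β γ).IsSteadyState N T_L T_R μ →
          (Literature.MathematicalPhysics.KineticTheory.HeatConduction.pinnedChain ω₂ lam β γ).IsSteadyState N T_L T_R ν →
          μ = ν) →
      ∀ μ : (N : ℕ) → ℝ → ℝ →
          Measure (Literature.MathematicalPhysics.KineticTheory.HeatConduction.PhaseSpace N),
        (∀ (N : ℕ) (T_L T_R : ℝ), 0 < T_L → 0 < T_R →
          (Literature.MathematicalPhysics.KineticTheory.HeatConduction.pinnedChain ω₂ lam β γ).IsSteadyState N T_L T_R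
            (μ N T_L T_R)) →
        ∀ T : ℝ, 0 < T → ∀ (N : ℕ) (i : Fin (N + 1)),
          Filter.Tendsto (fun δ : ℝ =>
              ((∫ z, (z.2 i) ^ 2 ∂(μ (N + 1) (T + δ / 2) (T - δ / 2))) - T) / δ)
            (nhdsWithin 0 {(0 : ℝ)}ᶜ)
            (nhds (γ / (2 * T ^ 2) *
              ((∫ t in Set.Ioi (0 : ℝ),
                ((∫ z, (z.2 0) ^ 2 * (∫ y, (y.2 i) ^ 2
                  ∂((Literature.MathematicalPhysics.KineticTheory.HeatConduction.pinnedChain ω₂ lam β γ).transitionKernel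
                    (N + 1) T T t.toNNReal z))
                  ∂((Literature.MathematicalPhysics.KineticTheory.HeatConduction.pinnedChain ω₂ lam β γ).gibbsMeasure
                    (N + 1) T)) -
                (∫ z, (z.2 0) ^ 2
                  ∂((Literature.MathematicalPhysics.KineticTheory.HeatConduction.pinnedChain ω₂ lam β γ).gibbsMeasure
                    (N + 1) T)) *
                  (∫ z, (∫ y, (y.2 i) ^ 2
                    ∂((Literature.MathematicalPhysics.KineticTheory.HeatConduction.pinnedChain ω₂ lam β γ).transitionKernel
                      (N + 1) T T t.toNNReal z))
                    ∂((Literature.MathematicalPhysics.KineticTheory.HeatConduction.pinnedChain ω₂ lam β γ).gibbsMeasure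
                      (N + 1) T)))) -
              (∫ t in Set.Ioi (0 : ℝ),
                ((∫ z, (z.2 (Fin.last N)) ^ 2 * (∫ y, (y.2 i) ^ 2
                  ∂((Literature.MathematicalPhysics.KineticTheory.HeatConduction.pinnedChain ω₂ lam β γ).transitionKernel
                    (N + 1) T T t.toNNReal z))
                  ∂((Literature.MathematicalPhysics.KineticTheory.HeatConduction.pinnedChain ω₂ lam β γ).gibbsMeasure
                    (N + 1) T)) -
                (∫ z, (z.2 (Fin.last N)) ^ 2
                  ∂((Literature.MathematicalPhysics.KineticTheory.HeatConduction.pinnedChain ω₂ lam β γ).gibbsMeasure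
                    (N + 1) T)) *
                  (∫ z, (∫ y, (y.2 i) ^ 2
                    ∂((Literature.MathematicalPhysics.KineticTheory.HeatConduction.pinnedChain ω₂ lam β γ).transitionKernel
                      (N + 1) T T t.toNNReal z))
                    ∂((Literature.MathematicalPhysics.KineticTheory.HeatConduction.pinnedChain ω₂ lam β γ).gibbsMeasure
                      (N + 1) T))))))) :=
  -- CLOSED (worker B, p104522): `Theorems/PuiseuxTransferLedgerTwoModeBulkStubProfileLimitExchange.lean`
  Summit.AtomisticToContinuum.FouriersLaw.Theorems.TwoModeBulk.Sketch.stub_profileLimitExchange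

/-- **Stub 3 — `stub_profileSumRule` (fixed `N`, size M) — CLOSED (worker C, cycle 1): the equilibrium sum rule AT EVERY SITE.** For the
`(N+1)`-site pinned chain (all parameters `> 0`), `T > 0`, `μ₀ = gibbsMeasure (N+1) T`, `K_t = transitionKernel (N+1) T T t`,
site `i`: `Y_i(t) = Cov_{μ₀}(p_0², K_t p_i²)` and `X_i(t) = Cov_{μ₀}(p_N², K_t p_i²)` are integrable on `(0,∞)` and
`∫₀^∞ Y_i + ∫₀^∞ X_i = T²/γ`.
VERBATIM the landed `BoundaryKubo.GibbsTtcf.stub_sumRule` (`Theorems/PhononMeanFreePathBoundaryKuboSumRule.lean`) with the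
observable `A = p_N²` replaced by `p_i²` (the weights `p_0²`, `p_N²` unchanged): `X_i + Y_i = -γ⁻¹ μ₀((LH)·K_t p_i²)`,
`LH = γ(2T - p_0² - p_N²)`; the energy-tested Dynkin identity `pinnedChain_sumRule_gibbs` (stated for a general
observable), Harris decay at the Gibbs state, and `Cov_{μ₀}(H, p_i²) = T²` (`integral_kinObs_mul_hamiltonian i`);
integrability from `pinnedChain_corr_integrableOn`. -/
theorem Holds.stub_profileSumRule :
    ∀ ω₂ lam β γ : ℝ, 0 < ω₂ → 0 < lam → 0 < β → 0 < γ → ∀ (N : ℕ) (T : ℝ), 0 < T → ∀ i : Fin (N + 1),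
      MeasureTheory.IntegrableOn (fun t : ℝ =>
          (∫ z, (z.2 0) ^ 2 * (∫ y, (y.2 i) ^ 2
            ∂((Literature.MathematicalPhysics.KineticTheory.HeatConduction.pinnedChain ω₂ lam β γ).transitionKernel
              (N + 1) T T t.toNNReal z))
            ∂((Literature.MathematicalPhysics.KineticTheory.HeatConduction.pinnedChain ω₂ lam β γ).gibbsMeasure
              (N + 1) T)) -
          (∫ z, (z.2 0) ^ 2
            ∂((Literature.MathematicalPhysics.KineticTheory.HeatConduction.pinnedChain ω₂ lam β γ).gibbsMeasure
              (N + 1) T)) *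
            (∫ z, (∫ y, (y.2 i) ^ 2
              ∂((Literature.MathematicalPhysics.KineticTheory.HeatConduction.pinnedChain ω₂ lam β γ).transitionKernel
                (N + 1) T T t.toNNReal z))
              ∂((Literature.MathematicalPhysics.KineticTheory.HeatConduction.pinnedChain ω₂ lam β γ).gibbsMeasure
                (N + 1) T)))
        (Set.Ioi 0) ∧
      MeasureTheory.IntegrableOn (fun t : ℝ =>
          (∫ z, (z.2 (Fin.last N)) ^ 2 * (∫ y, (y.2 i) ^ 2
            ∂((Literature.MathematicalPhysics.KineticTheory.HeatConduction.pinnedChain ω₂ lam β γ).transitionKernel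
              (N + 1) T T t.toNNReal z))
            ∂((Literature.MathematicalPhysics.KineticTheory.HeatConduction.pinnedChain ω₂ lam β γ).gibbsMeasure
              (N + 1) T)) -
          (∫ z, (z.2 (Fin.last N)) ^ 2
            ∂((Literature.MathematicalPhysics.KineticTheory.HeatConduction.pinnedChain ω₂ lam β γ).gibbsMeasure
              (N + 1) T)) *
            (∫ z, (∫ y, (y.2 i) ^ 2
              ∂((Literature.MathematicalPhysics.KineticTheory.HeatConduction.pinnedChain ω₂ lam β γ).transitionKernel
                (N + 1) T T t.toNNReal z))
              ∂((Literature.MathematicalPhysics.KineticTheory.HeatConduction.pinnedChain ω₂ lam β γ).gibbsMeasure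
                (N + 1) T)))
        (Set.Ioi 0) ∧
      (∫ t in Set.Ioi (0 : ℝ),
          ((∫ z, (z.2 0) ^ 2 * (∫ y, (y.2 i) ^ 2
            ∂((Literature.MathematicalPhysics.KineticTheory.HeatConduction.pinnedChain ω₂ lam β γ).transitionKernel
              (N + 1) T T t.toNNReal z))
            ∂((Literature.MathematicalPhysics.KineticTheory.HeatConduction.pinnedChain ω₂ lam β γ).gibbsMeasure
              (N + 1) T)) -
          (∫ z, (z.2 0) ^ 2
            ∂((Literature.MathematicalPhysics.KineticTheory.HeatConduction.pinnedChain ω₂ lam β γ).gibbsMeasure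
              (N + 1) T)) *
            (∫ z, (∫ y, (y.2 i) ^ 2
              ∂((Literature.MathematicalPhysics.KineticTheory.HeatConduction.pinnedChain ω₂ lam β γ).transitionKernel
                (N + 1) T T t.toNNReal z))
              ∂((Literature.MathematicalPhysics.KineticTheory.HeatConduction.pinnedChain ω₂ lam β γ).gibbsMeasure
                (N + 1) T)))) +
        (∫ t in Set.Ioi (0 : ℝ),
          ((∫ z, (z.2 (Fin.last N)) ^ 2 * (∫ y, (y.2 i) ^ 2
            ∂((Literature.MathematicalPhysics.KineticTheory.HeatConduction.pinnedChain ω₂ lam β γ).transitionKernel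
              (N + 1) T T t.toNNReal z))
            ∂((Literature.MathematicalPhysics.KineticTheory.HeatConduction.pinnedChain ω₂ lam β γ).gibbsMeasure
              (N + 1) T)) -
          (∫ z, (z.2 (Fin.last N)) ^ 2
            ∂((Literature.MathematicalPhysics.KineticTheory.HeatConduction.pinnedChain ω₂ lam β γ).gibbsMeasure
              (N + 1) T)) *
            (∫ z, (∫ y, (y.2 i) ^ 2
              ∂((Literature.MathematicalPhysics.KineticTheory.HeatConduction.pinnedChain ω₂ lam β γ).transitionKernel
                (N + 1) T T t.toNNReal z))
              ∂((Literature.MathematicalPhysics.KineticTheory.HeatConduction.pinnedChain ω₂ lam β γ).gibbsMeasure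
                (N + 1) T)))) = T ^ 2 / γ :=
  -- CLOSED (worker C): `Theorems/PuiseuxTransferLedgerTwoModeBulkStubProfileSumRule.lean`
  Summit.AtomisticToContinuum.FouriersLaw.Theorems.TwoModeBulk.Sketch.stub_profileSumRule

/-- **`TwoModeProfile` — the `N`-UNIFORM half of the line (crux-sized): the two-mode (Jordan) structure of the
EXPLICIT equilibrium response profile.** For the `(N+1)`-site pinned chain (all parameters `> 0`) and `T > 0`
write `μ₀ = gibbsMeasure (N+1) T`, `K_t = transitionKernel (N+1) T T t`, `Y_i(t) = Cov_{μ₀}(p_0², K_t p_i²)`,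
`u_N(i) := (γ/T²)∫₀^∞ Y_i - 1/2` (the cut-bond form of the kinetic-temperature response, = `t i` by stubs 1–3) and
`g_N := (γ²/T²)∫₀^∞ Y_N` (the per-bond conductance `D_{N+1}/N`, by `boundaryKubo_proof`). CLAIM: for every `T > 0`
there are `r ∈ ℝ`, `θ ∈ [0,1)`, `C`, NOT depending on `N`, with
`|u_N(i) - u_N(i+1) - r·g_N| ≤ C·|g_N|·(θ^i + θ^(N-1-i))` for every `N` and every bond `(i, i+1)` of `Fin (N+1)`.
A statement about ONE family of equilibrium time-integrated covariances of the open chain (no NESS, no response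
limit, no uniqueness). NOT a registered stub any more: it is DERIVED (`twoModeProfile_of`) from the two registered
stubs `stub_layerRelaxation` (Knudsen relaxation: geometric decay of the SECOND differences of `u_N` from both
contacts, amplitude `O(g_N)`) and `stub_bulkSlope` (the increment at the middle bond is `r g_N` up to `O(g_N θ^N)`),
which are jointly EQUIVALENT to it (telescoping; `Glue.twoMode_of_layer_and_slope`). Engines on offer (cards):
exponential locality + Toeplitz bulk of the precision matrix of the `ω = 0` kinetic kernel closed by a two-sided
discrete Wiener–Hopf lemma (`cut-bond-harmonic-measure`, `screened-precision-wiener-hopf`); the route's own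
frequency-twisted transfer / Puiseux continuation. Harmonic corner (`lam = β = 0`): true with `r = 0`. [folklore] -/
def TwoModeProfile : Prop :=
    ∀ ω₂ lam β γ : ℝ, 0 < ω₂ → 0 < lam → 0 < β → 0 < γ → ∀ T : ℝ, 0 < T →
      ∃ r θ C : ℝ, 0 ≤ θ ∧ θ < 1 ∧ ∀ (N : ℕ) (i j : Fin (N + 1)), j.val = i.val + 1 →
        |(γ / T ^ 2 * (∫ t in Set.Ioi (0 : ℝ),
            ((∫ z, (z.2 0) ^ 2 * (∫ y, (y.2 i) ^ 2
              ∂((Literature.MathematicalPhysics.KineticTheory.HeatConduction.pinnedChain ω₂ lam β γ).transitionKernel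
                (N + 1) T T t.toNNReal z))
              ∂((Literature.MathematicalPhysics.KineticTheory.HeatConduction.pinnedChain ω₂ lam β γ).gibbsMeasure
                (N + 1) T)) -
            (∫ z, (z.2 0) ^ 2
              ∂((Literature.MathematicalPhysics.KineticTheory.HeatConduction.pinnedChain ω₂ lam β γ).gibbsMeasure
                (N + 1) T)) *
              (∫ z, (∫ y, (y.2 i) ^ 2
                ∂((Literature.MathematicalPhysics.KineticTheory.HeatConduction.pinnedChain ω₂ lam β γ).transitionKernel
                  (N + 1) T T t.toNNReal z))
                ∂((Literature.MathematicalPhysics.KineticTheory.HeatConduction.pinnedChain ω₂ lam β γ).gibbsMeasure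
                  (N + 1) T)))) - 1 / 2) -
          (γ / T ^ 2 * (∫ t in Set.Ioi (0 : ℝ),
            ((∫ z, (z.2 0) ^ 2 * (∫ y, (y.2 j) ^ 2
              ∂((Literature.MathematicalPhysics.KineticTheory.HeatConduction.pinnedChain ω₂ lam β γ).transitionKernel
                (N + 1) T T t.toNNReal z))
              ∂((Literature.MathematicalPhysics.KineticTheory.HeatConduction.pinnedChain ω₂ lam β γ).gibbsMeasure
                (N + 1) T)) -
            (∫ z, (z.2 0) ^ 2
              ∂((Literature.MathematicalPhysics.KineticTheory.HeatConduction.pinnedChain ω₂ lam β γ).gibbsMeasure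
                (N + 1) T)) *
              (∫ z, (∫ y, (y.2 j) ^ 2
                ∂((Literature.MathematicalPhysics.KineticTheory.HeatConduction.pinnedChain ω₂ lam β γ).transitionKernel
                  (N + 1) T T t.toNNReal z))
                ∂((Literature.MathematicalPhysics.KineticTheory.HeatConduction.pinnedChain ω₂ lam β γ).gibbsMeasure
                  (N + 1) T)))) - 1 / 2) -
          r * ((γ ^ 2 / T ^ 2) * ∫ t in Set.Ioi (0 : ℝ),
            ((∫ z, (z.2 0) ^ 2 * (∫ y, (y.2 (Fin.last N)) ^ 2
              ∂((Literature.MathematicalPhysics.KineticTheory.HeatConduction.pinnedChain ω₂ lam β γ).transitionKernel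
                (N + 1) T T t.toNNReal z))
              ∂((Literature.MathematicalPhysics.KineticTheory.HeatConduction.pinnedChain ω₂ lam β γ).gibbsMeasure
                (N + 1) T)) -
            (∫ z, (z.2 0) ^ 2
              ∂((Literature.MathematicalPhysics.KineticTheory.HeatConduction.pinnedChain ω₂ lam β γ).gibbsMeasure
                (N + 1) T)) *
              (∫ z, (∫ y, (y.2 (Fin.last N)) ^ 2
                ∂((Literature.MathematicalPhysics.KineticTheory.HeatConduction.pinnedChain ω₂ lam β γ).transitionKernel
                  (N + 1) T T t.toNNReal z))
                ∂((Literature.MathematicalPhysics.KineticTheory.HeatConduction.pinnedChain ω₂ lam β γ).gibbsMeasure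
                  (N + 1) T))))| ≤
        C * |(γ ^ 2 / T ^ 2) * ∫ t in Set.Ioi (0 : ℝ),
            ((∫ z, (z.2 0) ^ 2 * (∫ y, (y.2 (Fin.last N)) ^ 2
              ∂((Literature.MathematicalPhysics.KineticTheory.HeatConduction.pinnedChain ω₂ lam β γ).transitionKernel
                (N + 1) T T t.toNNReal z))
              ∂((Literature.MathematicalPhysics.KineticTheory.HeatConduction.pinnedChain ω₂ lam β γ).gibbsMeasure
                (N + 1) T)) -
            (∫ z, (z.2 0) ^ 2
              ∂((Literature.MathematicalPhysics.KineticTheory.HeatConduction.pinnedChain ω₂ lam β γ).gibbsMeasure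
                (N + 1) T)) *
              (∫ z, (∫ y, (y.2 (Fin.last N)) ^ 2
                ∂((Literature.MathematicalPhysics.KineticTheory.HeatConduction.pinnedChain ω₂ lam β γ).transitionKernel
                  (N + 1) T T t.toNNReal z))
                ∂((Literature.MathematicalPhysics.KineticTheory.HeatConduction.pinnedChain ω₂ lam β γ).gibbsMeasure
                  (N + 1) T)))| * (θ ^ i.val + θ ^ (N - 1 - i.val)) 


/-- **Stub 4 — `stub_layerRelaxation` (`N`-UNIFORM, crux-sized; lead): LAYER RELAXATION.** With the notation of
`TwoModeProfile`: for every `T > 0` there are `θ ∈ [0,1)` and `C`, NOT depending on `N`, such that the SECOND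
differences of the explicit profile decay geometrically from both contacts with amplitude `O(g_N)`:
`|u_N(i) - 2u_N(i+1) + u_N(i+2)| ≤ C|g_N|(θ^i + θ^(N-2-i))` for all `N` and `i + 2 ≤ N` — the profile relaxes
to SOME locally Ohmic (affine) form within a Knudsen layer of `N`-independent thickness `-1/log θ` (kinetic content:
bounded mean free paths of the pinned dispersion; Milne problem). Says nothing about the VALUE of the bulk slope.
Why it might fail: unbounded mean free paths / a slow local mode ⇒ stretched-exponential or algebraic layers.
Harmonic corner: true (geometric layers, `HarmonicChainFlux.rootR`). -/
theorem Holds.stub_layerRelaxation :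
    ∀ ω₂ lam β γ : ℝ, 0 < ω₂ → 0 < lam → 0 < β → 0 < γ → ∀ T : ℝ, 0 < T →
      ∃ θ C : ℝ, 0 ≤ θ ∧ θ < 1 ∧ ∀ (N : ℕ) (i j k : Fin (N + 1)), j.val = i.val + 1 → k.val = i.val + 2 →
        |(γ / T ^ 2 * (∫ t in Set.Ioi (0 : ℝ),
            ((∫ z, (z.2 0) ^ 2 * (∫ y, (y.2 i) ^ 2
              ∂((Literature.MathematicalPhysics.KineticTheory.HeatConduction.pinnedChain ω₂ lam β γ).transitionKernel
                (N + 1) T T t.toNNReal z))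
              ∂((Literature.MathematicalPhysics.KineticTheory.HeatConduction.pinnedChain ω₂ lam β γ).gibbsMeasure
                (N + 1) T)) -
            (∫ z, (z.2 0) ^ 2
              ∂((Literature.MathematicalPhysics.KineticTheory.HeatConduction.pinnedChain ω₂ lam β γ).gibbsMeasure
                (N + 1) T)) *
              (∫ z, (∫ y, (y.2 i) ^ 2
                ∂((Literature.MathematicalPhysics.KineticTheory.HeatConduction.pinnedChain ω₂ lam β γ).transitionKernel
                  (N + 1) T T t.toNNReal z))
                ∂((Literature.MathematicalPhysics.KineticTheory.HeatConduction.pinnedChain ω₂ lam β γ).gibbsMeasure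
                  (N + 1) T)))) - 1 / 2) -
          2 * (γ / T ^ 2 * (∫ t in Set.Ioi (0 : ℝ),
            ((∫ z, (z.2 0) ^ 2 * (∫ y, (y.2 j) ^ 2
              ∂((Literature.MathematicalPhysics.KineticTheory.HeatConduction.pinnedChain ω₂ lam β γ).transitionKernel
                (N + 1) T T t.toNNReal z))
              ∂((Literature.MathematicalPhysics.KineticTheory.HeatConduction.pinnedChain ω₂ lam β γ).gibbsMeasure
                (N + 1) T)) -
            (∫ z, (z.2 0) ^ 2
              ∂((Literature.MathematicalPhysics.KineticTheory.HeatConduction.pinnedChain ω₂ lam β γ).gibbsMeasure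
                (N + 1) T)) *
              (∫ z, (∫ y, (y.2 j) ^ 2
                ∂((Literature.MathematicalPhysics.KineticTheory.HeatConduction.pinnedChain ω₂ lam β γ).transitionKernel
                  (N + 1) T T t.toNNReal z))
                ∂((Literature.MathematicalPhysics.KineticTheory.HeatConduction.pinnedChain ω₂ lam β γ).gibbsMeasure
                  (N + 1) T)))) - 1 / 2) +
          (γ / T ^ 2 * (∫ t in Set.Ioi (0 : ℝ),
            ((∫ z, (z.2 0) ^ 2 * (∫ y, (y.2 k) ^ 2
              ∂((Literature.MathematicalPhysics.KineticTheory.HeatConduction.pinnedChain ω₂ lam β γ).transitionKernel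
                (N + 1) T T t.toNNReal z))
              ∂((Literature.MathematicalPhysics.KineticTheory.HeatConduction.pinnedChain ω₂ lam β γ).gibbsMeasure
                (N + 1) T)) -
            (∫ z, (z.2 0) ^ 2
              ∂((Literature.MathematicalPhysics.KineticTheory.HeatConduction.pinnedChain ω₂ lam β γ).gibbsMeasure
                (N + 1) T)) *
              (∫ z, (∫ y, (y.2 k) ^ 2
                ∂((Literature.MathematicalPhysics.KineticTheory.HeatConduction.pinnedChain ω₂ lam β γ).transitionKernel
                  (N + 1) T T t.toNNReal z))
                ∂((Literature.MathematicalPhysics.KineticTheory.HeatConduction.pinnedChain ω₂ lam β γ).gibbsMeasure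
                  (N + 1) T)))) - 1 / 2)| ≤
        C * |((γ ^ 2 / T ^ 2) * ∫ t in Set.Ioi (0 : ℝ),
            Summit.AtomisticToContinuum.FouriersLaw.Theorems.BoundaryKubo.Negative.LoadBearing.kuboIntegrand
              ω₂ lam β γ T N t)| * (θ ^ i.val + θ ^ (N - 2 - i.val)) := by
  sorry

/-- **Stub 5 — `stub_bulkSlope` (`N`-UNIFORM, crux-sized; lead): EXPONENTIAL CONVERGENCE OF THE BULK SLOPE.**
With the notation of `TwoModeProfile`: for every `T > 0` there are `r`, `θ ∈ [0,1)`, `C`, NOT depending on `N`,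
such that at the MIDDLE bond `m = N/2` the increment of the explicit profile is `r g_N` up to an exponentially
small relative error: `|u_N(m) - u_N(m+1) - r g_N| ≤ C|g_N|θ^N` for all `N` — the mid-chain local resistivity
`r_N(m)` converges to ONE bulk resistivity `r(T)` exponentially fast in `N` (far-contact decoupling; `r` is NOT
asserted positive: `r = 0` at the harmonic corner). This is where the crux over-asks relative to the route's
`closes` (which needs only `(N-1)|r_N - r| = O(1)`): ANY polynomial finite-size correction `r_N(m) - r ≍ N^{-k}`
refutes it (and the crux as stated) while leaving Fourier's law intact — the disprover's natural target. -/
theorem Holds.stub_bulkSlope :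
    ∀ ω₂ lam β γ : ℝ, 0 < ω₂ → 0 < lam → 0 < β → 0 < γ → ∀ T : ℝ, 0 < T →
      ∃ r θ C : ℝ, 0 ≤ θ ∧ θ < 1 ∧ ∀ (N : ℕ) (i j : Fin (N + 1)), i.val = N / 2 → j.val = i.val + 1 →
        |(γ / T ^ 2 * (∫ t in Set.Ioi (0 : ℝ),
            ((∫ z, (z.2 0) ^ 2 * (∫ y, (y.2 i) ^ 2
              ∂((Literature.MathematicalPhysics.KineticTheory.HeatConduction.pinnedChain ω₂ lam β γ).transitionKernel
                (N + 1) T T t.toNNReal z))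
              ∂((Literature.MathematicalPhysics.KineticTheory.HeatConduction.pinnedChain ω₂ lam β γ).gibbsMeasure
                (N + 1) T)) -
            (∫ z, (z.2 0) ^ 2
              ∂((Literature.MathematicalPhysics.KineticTheory.HeatConduction.pinnedChain ω₂ lam β γ).gibbsMeasure
                (N + 1) T)) *
              (∫ z, (∫ y, (y.2 i) ^ 2
                ∂((Literature.MathematicalPhysics.KineticTheory.HeatConduction.pinnedChain ω₂ lam β γ).transitionKernel
                  (N + 1) T T t.toNNReal z))
                ∂((Literature.MathematicalPhysics.KineticTheory.HeatConduction.pinnedChain ω₂ lam β γ).gibbsMeasure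
                  (N + 1) T)))) - 1 / 2) -
          (γ / T ^ 2 * (∫ t in Set.Ioi (0 : ℝ),
            ((∫ z, (z.2 0) ^ 2 * (∫ y, (y.2 j) ^ 2
              ∂((Literature.MathematicalPhysics.KineticTheory.HeatConduction.pinnedChain ω₂ lam β γ).transitionKernel
                (N + 1) T T t.toNNReal z))
              ∂((Literature.MathematicalPhysics.KineticTheory.HeatConduction.pinnedChain ω₂ lam β γ).gibbsMeasure
                (N + 1) T)) -
            (∫ z, (z.2 0) ^ 2
              ∂((Literature.MathematicalPhysics.KineticTheory.HeatConduction.pinnedChain ω₂ lam β γ).gibbsMeasure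
                (N + 1) T)) *
              (∫ z, (∫ y, (y.2 j) ^ 2
                ∂((Literature.MathematicalPhysics.KineticTheory.HeatConduction.pinnedChain ω₂ lam β γ).transitionKernel
                  (N + 1) T T t.toNNReal z))
                ∂((Literature.MathematicalPhysics.KineticTheory.HeatConduction.pinnedChain ω₂ lam β γ).gibbsMeasure
                  (N + 1) T)))) - 1 / 2) -
          r * ((γ ^ 2 / T ^ 2) * ∫ t in Set.Ioi (0 : ℝ),
            Summit.AtomisticToContinuum.FouriersLaw.Theorems.BoundaryKubo.Negative.LoadBearing.kuboIntegrand
              ω₂ lam β γ T N t)| ≤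
        C * |((γ ^ 2 / T ^ 2) * ∫ t in Set.Ioi (0 : ℝ),
            Summit.AtomisticToContinuum.FouriersLaw.Theorems.BoundaryKubo.Negative.LoadBearing.kuboIntegrand
              ω₂ lam β γ T N t)| * θ ^ N := by
  sorry

/-! ### By-name handles of the five registered statements -/

/-- Statement of registered stub 1 (`Holds.stub_profileTTCF`), by name. -/
def stub_profileTTCF : Prop := type_of% Holds.stub_profileTTCF

/-- Statement of registered stub 2 (`Holds.stub_profileLimitExchange`), by name. -/
def stub_profileLimitExchange : Prop := type_of% Holds.stub_profileLimitExchange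

/-- Statement of registered stub 3 (`Holds.stub_profileSumRule`), by name. -/
def stub_profileSumRule : Prop := type_of% Holds.stub_profileSumRule

/-- Statement of registered stub 4 (`Holds.stub_layerRelaxation`), by name. -/
def stub_layerRelaxation : Prop := type_of% Holds.stub_layerRelaxation

/-- Statement of registered stub 5 (`Holds.stub_bulkSlope`), by name. -/
def stub_bulkSlope : Prop := type_of% Holds.stub_bulkSlope

/-! ## Part IIb — the `N`-uniform glue: layer relaxation + bulk slope ⇔ two-mode profile (sorry-free) -/

namespace Glue

open Finset

/-- Reversed geometric sum over an interval: `∑_{k ∈ [a,b)} θ^(n-k) ≤ θ^(n+1-b)/(1-θ)` for `b ≤ n + 1`,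
`0 ≤ θ < 1`. [folklore] -/
theorem geom_sum_Ico_rev_le {θ : ℝ} (h0 : 0 ≤ θ) (h1 : θ < 1) {a b n : ℕ} (hb : b ≤ n + 1) :
    ∑ k ∈ Finset.Ico a b, θ ^ (n - k) ≤ θ ^ (n + 1 - b) / (1 - θ) := by
  rw [Finset.sum_Ico_reflect (fun j => θ ^ j) a hb]
  exact geom_sum_Ico_le_of_lt_one h0 h1

/-- Telescoping of increments over an interval: `∑_{k ∈ [i,m)} (Δ k - Δ (k+1)) = Δ i - Δ m` for `i ≤ m`. [folklore] -/
theorem sum_Ico_sub_succ (Δ : ℕ → ℝ) {i m : ℕ} (him : i ≤ m) :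
    ∑ k ∈ Finset.Ico i m, (Δ k - Δ (k + 1)) = Δ i - Δ m := by
  rw [Finset.sum_Ico_eq_sum_range]
  have h := Finset.sum_range_sub' (fun k => Δ (i + k)) (m - i)
  simp only [add_zero, Nat.add_sub_cancel' him] at h
  rw [← h]
  refine Finset.sum_congr rfl fun k _ => ?_
  rw [add_assoc]

/-- **Two-mode glue.** Layer relaxation (geometric decay of second differences from both contacts, amplitude
`|g|`) and an exponentially accurate slope `r g` at the middle bond give the two-mode form of every increment,
with constants independent of `N`. [folklore] -/
theorem twoMode_of_layer_and_slope {θ C C' r g : ℝ} (h0 : 0 ≤ θ) (h1 : θ < 1) {N : ℕ} {u : ℕ → ℝ}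
    (hL : ∀ i : ℕ, i + 2 ≤ N → |u i - 2 * u (i + 1) + u (i + 2)| ≤ C * |g| * (θ ^ i + θ ^ (N - 2 - i)))
    (hB : 1 ≤ N → |u (N / 2) - u (N / 2 + 1) - r * g| ≤ C' * |g| * θ ^ N) :
    ∀ i : ℕ, i + 1 ≤ N →
      |u i - u (i + 1) - r * g| ≤ (max C' 0 + 2 * max C 0 / (1 - θ)) * |g| * (θ ^ i + θ ^ (N - 1 - i)) := by
  intro i hi
  set m := N / 2 with hm
  have hN : 1 ≤ N := by omega
  have h1θ : 0 < 1 - θ := by linarith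
  have hg : 0 ≤ |g| := abs_nonneg g
  have hC : C ≤ max C 0 := le_max_left _ _
  have hC0 : 0 ≤ max C 0 := le_max_right _ _
  have hC' : C' ≤ max C' 0 := le_max_left _ _
  have hC'0 : 0 ≤ max C' 0 := le_max_right _ _
  -- increments and their differences
  set Δ : ℕ → ℝ := fun k => u k - u (k + 1) with hΔ
  have hΔΔ : ∀ k : ℕ, k + 2 ≤ N → |Δ k - Δ (k + 1)| ≤ max C 0 * |g| * (θ ^ k + θ ^ (N - 2 - k)) := by
    intro k hk
    have e : Δ k - Δ (k + 1) = u k - 2 * u (k + 1) + u (k + 2) := by simp only [hΔ]; ring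
    rw [e]
    exact (hL k hk).trans (by gcongr)
  have hBm : |Δ m - r * g| ≤ max C' 0 * |g| * θ ^ N := (hB hN).trans (by gcongr)
  have hθpow : ∀ {a b : ℕ}, a ≤ b → θ ^ b ≤ θ ^ a := fun hab => pow_le_pow_of_le_one h0 h1.le hab
  have hθi : 0 ≤ θ ^ i := pow_nonneg h0 _
  have hθi' : 0 ≤ θ ^ (N - 1 - i) := pow_nonneg h0 _
  -- the key one-sided estimates
  have hK : 0 ≤ (max C' 0 + 2 * max C 0 / (1 - θ)) * |g| := by positivity
  rcases lt_trichotomy i m with him | rfl | hmi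
  · -- left half: telescope from `i` to `m`
    have htel : Δ i - Δ m = ∑ k ∈ Finset.Ico i m, (Δ k - Δ (k + 1)) := (sum_Ico_sub_succ Δ him.le).symm
    have hsum : |Δ i - Δ m| ≤ max C 0 * |g| * (θ ^ i / (1 - θ) + θ ^ i / (1 - θ)) := by
      rw [htel]
      refine (Finset.abs_sum_le_sum_abs _ _).trans ?_
      have hterm : ∀ k ∈ Finset.Ico i m, |Δ k - Δ (k + 1)| ≤ max C 0 * |g| * (θ ^ k + θ ^ (N - 2 - k)) := by
        intro k hk
        have hk' := (Finset.mem_Ico.mp hk).2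
        exact hΔΔ k (by omega)
      refine (Finset.sum_le_sum hterm).trans ?_
      rw [← Finset.mul_sum, Finset.sum_add_distrib]
      have hA : ∑ k ∈ Finset.Ico i m, θ ^ k ≤ θ ^ i / (1 - θ) := geom_sum_Ico_le_of_lt_one h0 h1
      have hB' : ∑ k ∈ Finset.Ico i m, θ ^ (N - 2 - k) ≤ θ ^ i / (1 - θ) :=
        calc ∑ k ∈ Finset.Ico i m, θ ^ (N - 2 - k) ≤ θ ^ (N - 2 + 1 - m) / (1 - θ) :=
              geom_sum_Ico_rev_le h0 h1 (by omega)
          _ ≤ θ ^ i / (1 - θ) := div_le_div_of_nonneg_right (hθpow (by omega)) h1θ.le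
      have hmul : 0 ≤ max C 0 * |g| := by positivity
      exact mul_le_mul_of_nonneg_left (add_le_add hA hB') hmul
    have hθN : θ ^ N ≤ θ ^ i := hθpow (by omega)
    calc |u i - u (i + 1) - r * g| = |(Δ i - Δ m) + (Δ m - r * g)| := by simp only [hΔ]; ring_nf
      _ ≤ |Δ i - Δ m| + |Δ m - r * g| := abs_add_le _ _
      _ ≤ max C 0 * |g| * (θ ^ i / (1 - θ) + θ ^ i / (1 - θ)) + max C' 0 * |g| * θ ^ N := add_le_add hsum hBm
      _ ≤ max C 0 * |g| * (θ ^ i / (1 - θ) + θ ^ i / (1 - θ)) + max C' 0 * |g| * θ ^ i := by gcongr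
      _ = (max C' 0 + 2 * max C 0 / (1 - θ)) * |g| * θ ^ i := by field_simp; ring
      _ ≤ (max C' 0 + 2 * max C 0 / (1 - θ)) * |g| * (θ ^ i + θ ^ (N - 1 - i)) := by nlinarith
  · -- the middle bond itself
    have hθN : θ ^ N ≤ θ ^ m := hθpow (by omega)
    calc |u m - u (m + 1) - r * g| = |Δ m - r * g| := by simp only [hΔ]
      _ ≤ max C' 0 * |g| * θ ^ N := hBm
      _ ≤ max C' 0 * |g| * θ ^ m := by gcongr
      _ ≤ (max C' 0 + 2 * max C 0 / (1 - θ)) * |g| * θ ^ m := by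
          have hθm : 0 ≤ θ ^ m := pow_nonneg h0 _
          have : max C' 0 * |g| ≤ (max C' 0 + 2 * max C 0 / (1 - θ)) * |g| := by
            apply mul_le_mul_of_nonneg_right _ hg
            have : 0 ≤ 2 * max C 0 / (1 - θ) := by positivity
            linarith
          exact mul_le_mul_of_nonneg_right this hθm
      _ ≤ (max C' 0 + 2 * max C 0 / (1 - θ)) * |g| * (θ ^ m + θ ^ (N - 1 - m)) := by nlinarith
  · -- right half: telescope from `m` to `i`
    have htel : Δ m - Δ i = ∑ k ∈ Finset.Ico m i, (Δ k - Δ (k + 1)) := (sum_Ico_sub_succ Δ hmi.le).symm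
    have hsum : |Δ m - Δ i| ≤ max C 0 * |g| * (θ ^ (N - 1 - i) / (1 - θ) + θ ^ (N - 1 - i) / (1 - θ)) := by
      rw [htel]
      refine (Finset.abs_sum_le_sum_abs _ _).trans ?_
      have hterm : ∀ k ∈ Finset.Ico m i, |Δ k - Δ (k + 1)| ≤ max C 0 * |g| * (θ ^ k + θ ^ (N - 2 - k)) := by
        intro k hk
        have hk' := (Finset.mem_Ico.mp hk).2
        exact hΔΔ k (by omega)
      refine (Finset.sum_le_sum hterm).trans ?_
      rw [← Finset.mul_sum, Finset.sum_add_distrib]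
      have hA : ∑ k ∈ Finset.Ico m i, θ ^ k ≤ θ ^ (N - 1 - i) / (1 - θ) :=
        calc ∑ k ∈ Finset.Ico m i, θ ^ k ≤ θ ^ m / (1 - θ) := geom_sum_Ico_le_of_lt_one h0 h1
          _ ≤ θ ^ (N - 1 - i) / (1 - θ) := div_le_div_of_nonneg_right (hθpow (by omega)) h1θ.le
      have hB' : ∑ k ∈ Finset.Ico m i, θ ^ (N - 2 - k) ≤ θ ^ (N - 1 - i) / (1 - θ) :=
        calc ∑ k ∈ Finset.Ico m i, θ ^ (N - 2 - k) ≤ θ ^ (N - 2 + 1 - i) / (1 - θ) :=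
              geom_sum_Ico_rev_le h0 h1 (by omega)
          _ ≤ θ ^ (N - 1 - i) / (1 - θ) := div_le_div_of_nonneg_right (hθpow (by omega)) h1θ.le
      have hmul : 0 ≤ max C 0 * |g| := by positivity
      exact mul_le_mul_of_nonneg_left (add_le_add hA hB') hmul
    have hθN : θ ^ N ≤ θ ^ (N - 1 - i) := hθpow (by omega)
    calc |u i - u (i + 1) - r * g| = |(Δ m - r * g) - (Δ m - Δ i)| := by simp only [hΔ]; ring_nf
      _ ≤ |Δ m - r * g| + |Δ m - Δ i| := abs_sub _ _
      _ ≤ max C' 0 * |g| * θ ^ N +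
          max C 0 * |g| * (θ ^ (N - 1 - i) / (1 - θ) + θ ^ (N - 1 - i) / (1 - θ)) := add_le_add hBm hsum
      _ ≤ max C' 0 * |g| * θ ^ (N - 1 - i) +
          max C 0 * |g| * (θ ^ (N - 1 - i) / (1 - θ) + θ ^ (N - 1 - i) / (1 - θ)) := by gcongr
      _ = (max C' 0 + 2 * max C 0 / (1 - θ)) * |g| * θ ^ (N - 1 - i) := by field_simp; ring
      _ ≤ (max C' 0 + 2 * max C 0 / (1 - θ)) * |g| * (θ ^ i + θ ^ (N - 1 - i)) := by nlinarith

end Glue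

/-- **`twoModeProfile_of`**: `stub_layerRelaxation → stub_bulkSlope → TwoModeProfile` (telescoping from the middle
bond; constants `r`, `θ = max θ_L θ_B`, `C = max C_B 0 + 2 max C_L 0/(1-θ)`, all `N`-independent). [folklore] -/
theorem twoModeProfile_of (hL : stub_layerRelaxation) (hB : stub_bulkSlope) : TwoModeProfile := by
  intro ω₂ lam β γ hω hl hβ hγ T hT
  obtain ⟨θ₁, C₁, h01, h11, hL'⟩ := hL ω₂ lam β γ hω hl hβ hγ T hT
  obtain ⟨r, θ₂, C₂, h02, h12, hB'⟩ := hB ω₂ lam β γ hω hl hβ hγ T hT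
  set θ := max θ₁ θ₂ with hθ
  have h0 : 0 ≤ θ := le_max_of_le_left h01
  have h1 : θ < 1 := max_lt h11 h12
  have hθ₁ : ∀ n : ℕ, θ₁ ^ n ≤ θ ^ n := fun n => pow_le_pow_left₀ h01 (le_max_left _ _) n
  have hθ₂ : ∀ n : ℕ, θ₂ ^ n ≤ θ ^ n := fun n => pow_le_pow_left₀ h02 (le_max_right _ _) n
  refine ⟨r, θ, max C₂ 0 + 2 * max C₁ 0 / (1 - θ), h0, h1, ?_⟩
  intro N i j hij
  -- the profile as a sequence on `ℕ` (junk `0` beyond the chain) and the per-bond conductance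
  set g : ℝ := (γ ^ 2 / T ^ 2) * ∫ t in Set.Ioi (0 : ℝ), kuboIntegrand ω₂ lam β γ T N t with hg
  set u : ℕ → ℝ := fun n => if h : n < N + 1 then profileValue ω₂ lam β γ T N ⟨n, h⟩ else 0 with hu
  have hu_apply : ∀ k : Fin (N + 1), u k.val = profileValue ω₂ lam β γ T N k := fun k => by
    simp only [hu, dif_pos k.isLt]
  have hu_apply' : ∀ (n : ℕ) (h : n < N + 1), u n = profileValue ω₂ lam β γ T N ⟨n, h⟩ := fun n h => by
    simp only [hu, dif_pos h]
  have hgn : 0 ≤ |g| := abs_nonneg g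
  -- layer relaxation for `u`
  have hLu : ∀ n : ℕ, n + 2 ≤ N → |u n - 2 * u (n + 1) + u (n + 2)| ≤ max C₁ 0 * |g| * (θ ^ n + θ ^ (N - 2 - n)) := by
    intro n hn
    have h : |profileValue ω₂ lam β γ T N ⟨n, by omega⟩ - 2 * profileValue ω₂ lam β γ T N ⟨n + 1, by omega⟩ +
        profileValue ω₂ lam β γ T N ⟨n + 2, by omega⟩| ≤ C₁ * |g| * (θ₁ ^ n + θ₁ ^ (N - 2 - n)) :=
      hL' N ⟨n, by omega⟩ ⟨n + 1, by omega⟩ ⟨n + 2, by omega⟩ rfl rfl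
    rw [hu_apply' n (by omega), hu_apply' (n + 1) (by omega), hu_apply' (n + 2) (by omega)]
    refine h.trans ?_
    have hS : 0 ≤ θ₁ ^ n + θ₁ ^ (N - 2 - n) := add_nonneg (pow_nonneg h01 _) (pow_nonneg h01 _)
    calc C₁ * |g| * (θ₁ ^ n + θ₁ ^ (N - 2 - n)) ≤ max C₁ 0 * |g| * (θ₁ ^ n + θ₁ ^ (N - 2 - n)) :=
          mul_le_mul_of_nonneg_right (mul_le_mul_of_nonneg_right (le_max_left _ _) hgn) hS
      _ ≤ max C₁ 0 * |g| * (θ ^ n + θ ^ (N - 2 - n)) :=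
          mul_le_mul_of_nonneg_left (add_le_add (hθ₁ _) (hθ₁ _)) (by positivity)
  -- bulk slope for `u`
  have hBu : 1 ≤ N → |u (N / 2) - u (N / 2 + 1) - r * g| ≤ max C₂ 0 * |g| * θ ^ N := by
    intro hN
    have h : |profileValue ω₂ lam β γ T N ⟨N / 2, by omega⟩ - profileValue ω₂ lam β γ T N ⟨N / 2 + 1, by omega⟩ -
        r * g| ≤ C₂ * |g| * θ₂ ^ N :=
      hB' N ⟨N / 2, by omega⟩ ⟨N / 2 + 1, by omega⟩ rfl rfl
    rw [hu_apply' (N / 2) (by omega), hu_apply' (N / 2 + 1) (by omega)]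
    refine h.trans ?_
    calc C₂ * |g| * θ₂ ^ N ≤ max C₂ 0 * |g| * θ₂ ^ N :=
          mul_le_mul_of_nonneg_right (mul_le_mul_of_nonneg_right (le_max_left _ _) hgn) (pow_nonneg h02 _)
      _ ≤ max C₂ 0 * |g| * θ ^ N := mul_le_mul_of_nonneg_left (hθ₂ _) (by positivity)
  -- glue, at the bond `(i, j)`
  have hi : i.val + 1 ≤ N := by have := j.isLt; omega
  have hglue := Glue.twoMode_of_layer_and_slope h0 h1 hLu hBu i.val hi
  have e1 : u i.val = profileValue ω₂ lam β γ T N i := hu_apply i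
  have e2 : u (i.val + 1) = profileValue ω₂ lam β γ T N j := by rw [← hij]; exact hu_apply j
  rw [e1, e2, max_eq_left (le_max_right C₂ 0), max_eq_left (le_max_right C₁ 0)] at hglue
  exact hglue

/-! ## Part III — fixed-`N` glue (sorry-free) -/

section Glue

variable {ω₂ lam β γ : ℝ} (hω : 0 < ω₂) (hl : 0 < lam) (hβ : 0 < β) (hγ : 0 < γ)

include hω hl hβ in
/-- Under uniqueness the equal-temperature member of a steady family is the Gibbs state, whose kinetic
temperature is `T` at every site. [folklore] -/
theorem integral_sq_momentum_family_self (hU : UniqueSteady ω₂ lam β γ)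
    {μ : (M : ℕ) → ℝ → ℝ → Measure (PhaseSpace M)} (hμ : SteadyFamily ω₂ lam β γ μ) {T : ℝ} (hT : 0 < T)
    (M : ℕ) (i : Fin M) : ∫ x, (x.2 i) ^ 2 ∂(μ M T T) = T := by
  rw [steadyFamily_apply_self hω hl hβ hU hμ hT M]
  exact integral_momentum_sq_gibbsMeasure hω hl.le hβ hT M i

include hω hl hβ hγ in
/-- **The profile response exists and equals `responseValue`** (stubs 1 + 2, read in the crux's normalisation:
the subtracted equilibrium value `μ_{N+1,T,T}(p_i²)` is `T`). [folklore] -/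
theorem tendsto_profile_of_stubs (h1 : stub_profileTTCF) (h2 : stub_profileLimitExchange)
    (hU : UniqueSteady ω₂ lam β γ) {μ : (M : ℕ) → ℝ → ℝ → Measure (PhaseSpace M)}
    (hμ : SteadyFamily ω₂ lam β γ μ) {T : ℝ} (hT : 0 < T) (N : ℕ) (i : Fin (N + 1)) :
    Tendsto (fun δ : ℝ => ((∫ x, (x.2 i) ^ 2 ∂(μ (N + 1) (T + δ / 2) (T - δ / 2))) -
        ∫ x, (x.2 i) ^ 2 ∂(μ (N + 1) T T)) / δ) (𝓝[≠] 0) (𝓝 (responseValue ω₂ lam β γ T N i)) := by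
  have h := h2 h1 ω₂ lam β γ hω hl hβ hγ hU μ hμ T hT N i
  rw [integral_sq_momentum_family_self hω hl hβ hU hμ hT (N + 1) i]
  exact h

include hω hl hβ hγ in
/-- **The cut-bond form**: with the sum rule (stub 3), `responseValue = profileValue = (γ/T²)∫₀^∞ Y_i - 1/2`.
[folklore] -/
theorem responseValue_eq_profileValue (h3 : stub_profileSumRule) {T : ℝ} (hT : 0 < T) (N : ℕ) (i : Fin (N + 1)) :
    responseValue ω₂ lam β γ T N i = profileValue ω₂ lam β γ T N i := by
  obtain ⟨-, -, hsum⟩ := h3 ω₂ lam β γ hω hl hβ hγ N T hT i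
  have hX : (∫ t in Ioi (0 : ℝ), rightIntegrand ω₂ lam β γ T N i t) =
      T ^ 2 / γ - ∫ t in Ioi (0 : ℝ), leftIntegrand ω₂ lam β γ T N i t := by
    have : (∫ t in Ioi (0 : ℝ), leftIntegrand ω₂ lam β γ T N i t) +
        (∫ t in Ioi (0 : ℝ), rightIntegrand ω₂ lam β γ T N i t) = T ^ 2 / γ := hsum
    linarith
  unfold responseValue profileValue
  rw [hX]
  have hT0 : T ≠ 0 := hT.ne'
  have hγ0 : γ ≠ 0 := hγ.ne'
  field_simp
  ring

include hω hl hβ hγ in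
/-- The response coefficient of the `(N+1)`-site chain along the family is `kuboValue` (`boundaryKubo_proof`),
hence any limit `d` of the crux's current quotient IS `kuboValue`. [folklore] -/
theorem eq_kuboValue_of_tendsto (hU : UniqueSteady ω₂ lam β γ) {μ : (M : ℕ) → ℝ → ℝ → Measure (PhaseSpace M)}
    (hμ : SteadyFamily ω₂ lam β γ μ) {T : ℝ} (hT : 0 < T) (N : ℕ) {d : ℝ}
    (hd : Tendsto (fun δ : ℝ =>
        (pinnedChain ω₂ lam β γ).totalCurrent (μ (N + 1) (T + δ / 2) (T - δ / 2)) / δ) (𝓝[≠] 0) (𝓝 d)) :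
    d = kuboValue ω₂ lam β γ T N := by
  have hK := (boundaryKubo_iff.mp boundaryKubo_proof ω₂ lam β γ hω hl hβ hγ hU μ hμ T hT N).2
  exact tendsto_nhds_unique hd hK

end Glue

/-! ## Part IV — the skeleton theorem: the two open stubs give the crux BY NAME (sorry-free; stubs 1–3 are landed) -/

/-- **The fixed-`N` core**: `TwoModeProfile` gives the BODY of the crux (stated unfolded, so that the registered skeleton
theorem below is the first declaration concluding the crux by name). Limits along `𝓝[≠] 0` are unique, so the crux's
`d` and `t i` are the explicit equilibrium values (`kuboValue` by `boundaryKubo_proof`; `profileValue` by the LANDED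
stubs 1–3); `TwoModeProfile` is then the crux's inequality (`(N+1) - 1 = N`, `(N+1) - 2 - i = N - 1 - i`). [folklore] -/
theorem core_of_profile (h4 : TwoModeProfile) :
    ∀ ω₂ lam β γ : ℝ, 0 < ω₂ → 0 < lam → 0 < β → 0 < γ → (∀ (N : ℕ) (T_L T_R : ℝ), 0 < T_L → 0 < T_R → ∀ μ ν : MeasureTheory.Measure (Literature.MathematicalPhysics.KineticTheory.HeatConduction.PhaseSpace N), (Literature.MathematicalPhysics.KineticTheory.HeatConduction.pinnedChain ω₂ lam β γ).IsSteadyState N T_L T_R μ → (Literature.MathematicalPhysics.KineticTheory.HeatConduction.pinnedChain ω₂ lam β γ).IsSteadyState N T_L T_R ν → μ = ν) → ∀ μ : (N : ℕ) → ℝ → ℝ → MeasureTheory.Measure (Literature.MathematicalPhysics.KineticTheory.HeatConduction.PhaseSpace N), (∀ (N : ℕ) (T_L T_R : ℝ), 0 < T_L → 0 < T_R → (Literature.MathematicalPhysics.KineticTheory.HeatConduction.pinnedChain ω₂ lam β γ).IsSteadyState N T_L T_R (μ N T_L T_R)) → ∀ T : ℝ, 0 < T → ∃ r θ C : ℝ,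 0 ≤ θ ∧ θ < 1 ∧ ∀ (N : ℕ) (d : ℝ) (t : Fin N → ℝ), Filter.Tendsto (fun δ : ℝ => (Literature.MathematicalPhysics.KineticTheory.HeatConduction.pinnedChain ω₂ lam β γ).totalCurrent (μ N (T + δ / 2) (T - δ / 2)) / δ) (nhdsWithin 0 {(0 : ℝ)}ᶜ) (nhds d) → (∀ i : Fin N, Filter.Tendsto (fun δ : ℝ => ((∫ x, (x.2 i) ^ 2 ∂(μ N (T + δ / 2) (T - δ / 2))) - ∫ x, (x.2 i) ^ 2 ∂(μ N T T)) / δ) (nhdsWithin 0 {(0 : ℝ)}ᶜ) (nhds (t i))) → ∀ i j : Fin N, j.val = i.val + 1 → |t i - t j - r * (d / ((N : ℝ) - 1))| ≤ C * |d / ((N : ℝ) - 1)| * (θ ^ i.val + θ ^ (N - 2 - i.val)) := by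
  intro ω₂ lam β γ hω hl hβ hγ hU μ hμ T hT
  obtain ⟨r, θ, C, hθ0, hθ1, hlayer⟩ := h4 ω₂ lam β γ hω hl hβ hγ T hT
  refine ⟨r, θ, C, hθ0, hθ1, ?_⟩
  intro N d t hd ht i j hij
  cases N with
  | zero => exact i.elim0
  | succ M =>
    -- identification of the limits with the explicit values
    have hdK : d = kuboValue ω₂ lam β γ T M := eq_kuboValue_of_tendsto hω hl hβ hγ hU hμ hT M hd
    have hti : ∀ k : Fin (M + 1), t k = profileValue ω₂ lam β γ T M k := fun k => by
      have h := tendsto_profile_of_stubs hω hl hβ hγ Holds.stub_profileTTCF Holds.stub_profileLimitExchange hU hμ hT M k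
      rw [responseValue_eq_profileValue hω hl hβ hγ Holds.stub_profileSumRule hT M k] at h
      exact tendsto_nhds_unique (ht k) h
    have hcast : ((M + 1 : ℕ) : ℝ) - 1 = (M : ℝ) := by push_cast; ring
    have hsub : M + 1 - 2 - i.val = M - 1 - i.val := by omega
    rw [hti i, hti j, hdK, hcast, hsub]
    have hl' := hlayer M i j hij
    -- `kuboValue / M` is the per-bond conductance `(γ²/T²)∫Y_M` when `M ≠ 0`; for `M = 0` there is no bond
    rcases Nat.eq_zero_or_pos M with hM | hM
    · subst hM
      exact absurd hij (by omega)
    · have hMne : (M : ℝ) ≠ 0 := by exact_mod_cast hM.ne'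
      have hg : kuboValue ω₂ lam β γ T M / (M : ℝ) =
          (γ ^ 2 / T ^ 2) * ∫ t in Set.Ioi (0 : ℝ), kuboIntegrand ω₂ lam β γ T M t := by
        unfold kuboValue
        field_simp
      rw [hg]
      exact hl'

/-- **`TwoModeBulk_of` — THE SKELETON THEOREM**: `stub_layerRelaxation → stub_bulkSlope → PuiseuxTransferLedger.TwoModeBulk`
(the three fixed-`N` stubs are landed theorems and enter through `core_of_profile`; the two `N`-uniform stubs enter through
`twoModeProfile_of`). [folklore] -/
theorem TwoModeBulk_of (hL : stub_layerRelaxation) (hB : stub_bulkSlope) :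
    Summit.AtomisticToContinuum.FouriersLaw.Theses.PuiseuxTransferLedger.TwoModeBulk :=
  core_of_profile (twoModeProfile_of hL hB)

/-- The composed theorem on the `Holds.*` proofs (becomes a proof of the crux once the two remaining `sorry`s are
discharged). [folklore] -/
theorem twoModeBulk_holds_of_skeleton :
    Summit.AtomisticToContinuum.FouriersLaw.Theses.PuiseuxTransferLedger.TwoModeBulk :=
  TwoModeBulk_of Holds.stub_layerRelaxation Holds.stub_bulkSlope

/-! ## Part V — by-products for the route (sorry-free given the fixed-`N` stubs) -/

/-- **Stubs 1 + 2 give the route's support item `FiniteResponseProfile`** (stmt-AtomisticToContinuum-12011, shared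
2742): the kinetic-temperature response profile exists at every site. [folklore] -/
theorem finiteResponseProfile_of_stubs (h1 : stub_profileTTCF) (h2 : stub_profileLimitExchange) :
    Summit.AtomisticToContinuum.FouriersLaw.Theses.PuiseuxTransferLedger.FiniteResponseProfile := by
  intro ω₂ lam β γ hω hl hβ hγ hU μ hμ T hT N i
  cases N with
  | zero => exact i.elim0
  | succ M => exact ⟨_, tendsto_profile_of_stubs hω hl hβ hγ h1 h2 hU hμ hT M i⟩


/-! ## Part VI — the reduction is lossless: the crux implies `TwoModeProfile` (sorry-free, uses the landed stubs 1–3) -/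

/-- **`twoModeProfile_of_twoModeBulk`**: conversely `TwoModeBulk → TwoModeProfile`. Instantiate the crux at a steady family
obtained by choice from the landed existence theorem `pinnedChain_exists_isSteadyState` and at the proved uniqueness
`NessUnique_holds`; by `boundaryKubo_proof` and stubs 1–3 its `d`, `t` may be taken to be `kuboValue`, `profileValue`.
Hence the crux IS (equivalent to) a two-mode property of one explicit family of equilibrium time-integrated kinetic
covariances of the open chain: refuting `TwoModeProfile` refutes the crux. [folklore] -/
theorem twoModeProfile_of_twoModeBulk
    (hTM : Summit.AtomisticToContinuum.FouriersLaw.Theses.PuiseuxTransferLedger.TwoModeBulk) : TwoModeProfile := by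
  intro ω₂ lam β γ hω hl hβ hγ T hT
  -- uniqueness (landed) and a steady family by choice (junk `0` outside positive temperatures)
  have hU : UniqueSteady ω₂ lam β γ :=
    Summit.AtomisticToContinuum.FouriersLaw.Theses.PuiseuxTransferLedger.NessUnique_holds ω₂ lam β γ hω hl hβ hγ
  have hfam : ∀ (M : ℕ) (a b : ℝ), ∃ ν : Measure (PhaseSpace M),
      (0 < a → 0 < b → (pinnedChain ω₂ lam β γ).IsSteadyState M a b ν) := by
    intro M a b
    by_cases h : 0 < a ∧ 0 < b
    · obtain ⟨ν, hν⟩ := pinnedChain_exists_isSteadyState hω hl hβ hγ M h.1 h.2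
      exact ⟨ν, fun _ _ => hν⟩
    · exact ⟨0, fun ha hb => absurd ⟨ha, hb⟩ h⟩
  choose μ hμ' using hfam
  have hμ : SteadyFamily ω₂ lam β γ μ := fun M a b ha hb => hμ' M a b ha hb
  obtain ⟨r, θ, C, h0, h1, hmain⟩ := hTM ω₂ lam β γ hω hl hβ hγ hU μ hμ T hT
  refine ⟨r, θ, C, h0, h1, fun N i j hij => ?_⟩
  -- the crux at `N + 1` sites with the explicit limits
  have hd := (boundaryKubo_iff.mp boundaryKubo_proof ω₂ lam β γ hω hl hβ hγ hU μ hμ T hT N).2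
  have ht : ∀ k : Fin (N + 1), Tendsto (fun δ : ℝ => ((∫ x, (x.2 k) ^ 2 ∂(μ (N + 1) (T + δ / 2) (T - δ / 2))) -
      ∫ x, (x.2 k) ^ 2 ∂(μ (N + 1) T T)) / δ) (𝓝[≠] 0) (𝓝 (profileValue ω₂ lam β γ T N k)) := fun k => by
    have h := tendsto_profile_of_stubs hω hl hβ hγ Holds.stub_profileTTCF Holds.stub_profileLimitExchange hU hμ hT N k
    rwa [responseValue_eq_profileValue hω hl hβ hγ Holds.stub_profileSumRule hT N k] at h
  have h := hmain (N + 1) (kuboValue ω₂ lam β γ T N) (fun k => profileValue ω₂ lam β γ T N k) hd ht i j hij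
  have hcast : ((N + 1 : ℕ) : ℝ) - 1 = (N : ℝ) := by push_cast; ring
  have hsub : N + 1 - 2 - i.val = N - 1 - i.val := by omega
  rw [hcast, hsub] at h
  rcases Nat.eq_zero_or_pos N with hN | hN
  · subst hN
    exact absurd hij (by omega)
  · have hMne : (N : ℝ) ≠ 0 := by exact_mod_cast hN.ne'
    have hg : kuboValue ω₂ lam β γ T N / (N : ℝ) =
        (γ ^ 2 / T ^ 2) * ∫ t in Set.Ioi (0 : ℝ), kuboIntegrand ω₂ lam β γ T N t := by
      unfold kuboValue
      field_simp
    rw [hg] at h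
    exact h

/-- **The crux is equivalent to `TwoModeProfile`** (given the landed fixed-`N` stubs): `core_of_profile` is the closed
REDUCTION `TwoModeProfile → TwoModeBulk`, `twoModeProfile_of_twoModeBulk` its converse. [folklore] -/
theorem twoModeBulk_iff_twoModeProfile :
    Summit.AtomisticToContinuum.FouriersLaw.Theses.PuiseuxTransferLedger.TwoModeBulk ↔ TwoModeProfile :=
  ⟨twoModeProfile_of_twoModeBulk, fun h => core_of_profile h⟩

end Summit.AtomisticToContinuum.FouriersLaw.Cruxes.TwoModeBulk.Sketch

end
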